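import Summits.NavierStokesRegularity.NavierStokesRegularity.Theses.AxisymmetricExtremality
import Summits.NavierStokesRegularity.NavierStokesRegularity.Theorems.AxisymmetricExtremalityAxisymmetricKatoGlobalReduction
import Summits.NavierStokesRegularity.NavierStokesRegularity.Theorems.AxisymmetricExtremalityAxisymmetricKatoGlobalStubSereginLogSwirlOrigin
import Summits.NavierStokesRegularity.NavierStokesRegularity.Theorems.AxisymmetricExtremalityAxisymmetricKatoGlobalStubKatoAxisymSingularPoint
import Summits.NavierStokesRegularity.NavierStokesRegularity.Theorems.AxisymmetricExtremalityAxisymmetricKatoGlobalStubKatoLocalEnergyNearTop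
import Summits.NavierStokesRegularity.NavierStokesRegularity.Theorems.AxisymmetricExtremalityAxisymmetricKatoGlobalStubOffAxisBoundedOfLocalEnergy
import Literature.Analysis.FluidPDE.RusinSverakCompactness
import Literature.Analysis.FluidPDE.AxisymmetricTypeIBounded
import HarnessLib.Audit

/-!
# Strategist census sketch (family `s`, gen 9) — crux `AxisymmetricExtremality.AxisymmetricKatoGlobal`

Crux item `stmt-NavierStokesRegularity-15453` of `route-NavierStokesRegularity-AxisymmetricExtremality`.
This scratch file types the statements used in `STRATEGY-CENSUS-s19.md` (second, independent
census) and kernel-checks the three implications the census leans on: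

* `akg_of_swirlAxisModulus` — given the tree, the crux follows from the ONE open stub of the
  registered line (`stub_swirlAxisModulus`) by a single application of landed theorems
  (`AxisymmetricKatoGlobal_of_logSwirlFacts`, `seregin2022_logSwirl_regularAtOrigin_holds`);
* `noAxisymMinimalBlowup_of_akg` — the "weaker intermediate" actually consumed by `closes`
  (no axisymmetric Rusin–Šverák minimal blow-up datum) is a formal consequence of the crux;
* `akg_of_endpoint_of_continuity` — the best typed decomposition found (D7):
  `SmallSwirlEndpointCriterion → AxisSwirlContinuity → AxisymmetricKatoGlobal`, assembled from the
  landed stubs 1, K, 2b' of the registered skeleton; and `axisSwirlContinuity_of_swirlAxisModulus`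
  (the continuity half is formally WEAKER than the registered stub 3).

Nothing here is proposed to the tree; no stub of the lead's skeleton is touched.
-/

noncomputable section

open Set MeasureTheory Filter Topology Function Metric
open scoped ENNReal NNReal
open Literature.Analysis.FluidPDE Literature.Analysis.FunctionSpaces

namespace Summit.NavierStokesRegularity.NavierStokesRegularity.Cruxes.AxisymmetricKatoGlobal.StrategistS19g9

set_option linter.unusedVariables false
set_option linter.dupNamespace false

local notation "ℝ³" => EuclideanSpace ℝ (Fin 3)

open Summit.NavierStokesRegularity.NavierStokesRegularity.Theses.AxisymmetricExtremality
  (AxisymmetricKatoGlobal)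
open Summit.NavierStokesRegularity.NavierStokesRegularity.Theorems.AxisymmetricKatoGlobal

/-! ## §0  The registered line's one open stub, as a `Prop` (verbatim `stub_swirlAxisModulus`). -/

/-- The logarithmic axis modulus of the swirl of a smooth axisymmetric Kato solution up to its
final time (verbatim the statement of `Cruxes/AxisymmetricKatoGlobal/Lines/registered.lean:
stub_swirlAxisModulus`, the only open stub of the registered skeleton). -/
def SwirlAxisModulus : Prop :=
  ∀ ν : ℝ, 0 < ν → ∀ T : ℝ, 0 < T → ∀ (u₀ : ℝ³ → ℝ³)
    (g : HomSobolev ℝ³ (EuclideanSpace ℂ (Fin 3)) (1 / 2 : ℝ)) (u : ℝ → ℝ³ → ℝ³),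
    g.Represents (Literature.Analysis.FunctionSpaces.EuclideanSpace.complexify ∘ u₀) →
    IsKatoSolutionOn T ν u₀ u → ContDiffOn ℝ (⊤ : ℕ∞) (uncurry u) (Ioo 0 T ×ˢ univ) →
    (∀ t ∈ Ioo 0 T, IsAxisymmetric (u t)) →
    ∀ t₀ ∈ Ioo 0 T, ∃ C δ₀ : ℝ, 0 < δ₀ ∧ δ₀ < 1 ∧
      ∀ t ∈ Ico t₀ T, ∀ x : ℝ³, cylRadius x ≤ δ₀ →
        |swirl (u t) x| ≤ C / |Real.log (cylRadius x)| ^ 3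

/-- KERNEL CERTIFICATE 1.  Given the tree (Seregin 2022 discharged by
`seregin2022_logSwirl_regularAtOrigin_holds`; stubs 1, K, 2b', 2c' inlined in
`AxisymmetricKatoGlobal_of_logSwirlFacts`), the crux follows from `SwirlAxisModulus` alone. -/
theorem akg_of_swirlAxisModulus (h : SwirlAxisModulus) : AxisymmetricKatoGlobal :=
  Registered.AxisymmetricKatoGlobal_of_logSwirlFacts
    EulerScaling.seregin2022_logSwirl_regularAtOrigin_holds h

/-! ## §1  Weaker intermediate: the threshold instance consumed by `closes`. -/

/-- No axisymmetric Rusin–Šverák `Ḣ^{1/2}`-minimal blow-up datum exists (for any viscosity).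
This is EXACTLY what the route's `closes` consumes from the crux (`h₃` is applied once, to the
axisymmetric minimal datum produced by `MinimalDatumPFold` + `PFoldToAxisymmetric`). -/
def NoAxisymMinimalBlowup : Prop :=
  ∀ ν : ℝ, 0 < ν → ∀ (u₀ : ℝ³ → ℝ³) (g : HomSobolev ℝ³ (EuclideanSpace ℂ (Fin 3)) (1 / 2 : ℝ)),
    IsMinimalBlowupDatum ν u₀ g → IsAxisymmetric u₀ → False

/-- KERNEL CERTIFICATE 2.  The threshold instance is a formal consequence of the crux. -/
theorem noAxisymMinimalBlowup_of_akg (h : AxisymmetricKatoGlobal) : NoAxisymMinimalBlowup := by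
  intro ν hν u₀ g hmin hax
  obtain ⟨hL3, hrep, hdiv, -, hng⟩ := hmin
  exact hng (h ν hν u₀ g hL3 hrep hdiv (fun θ x => hax θ x))

/-! ## §2  Decomposition D7: endpoint small-swirl criterion ∧ continuity of the swirl at the axis. -/

/-- **P1 — endpoint (d = 1) small-swirl criterion, local at axis points.**  There is an absolute
`ε₀ > 0` such that: for a suitable weak solution `(u, p)` of the unforced equations (viscosity
`ν > 0`) on the strip `(0,T) × ℝ³`, `u` smooth with axisymmetric slices, `p` with axisymmetric
slices, local energy classes reaching the final time, IF the swirl `Γ = r u_θ` satisfies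
`|Γ(t,x)| ≤ ε₀ ν` for `cylRadius x ≤ δ₀`, `t ∈ [t₀, T)` (some `t₀ < T`, `δ₀ > 0`), THEN `u` is
bounded near `(T, x₀)` at every axis point `x₀`.  (The `d = 1` endpoint of Chen–Fang–Zhang 2017
Thm 1.1(2) `r^d |ln r|^{-3/2}`-type / Lei–Zhang 2017 Cor. 1.3 `|ln r|^{-2}` / Wei 2016
`|ln r|^{-3/2}` / Seregin 2022 `ln^{-3}` criteria: smallness WITHOUT a logarithmic rate.) -/
def SmallSwirlEndpointCriterion : Prop :=
  ∃ ε₀ : ℝ, 0 < ε₀ ∧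
    ∀ ν : ℝ, 0 < ν → ∀ T : ℝ, 0 < T → ∀ (u : ℝ → ℝ³ → ℝ³) (p : ℝ → ℝ³ → ℝ),
      ContDiffOn ℝ (⊤ : ℕ∞) (uncurry u) (Ioo 0 T ×ˢ univ) →
      (∀ t ∈ Ioo 0 T, IsAxisymmetric (u t)) →
      (∀ t ∈ Ioo 0 T, IsAxisymmetricScalar (p t)) →
      IsSuitableWeakSolutionOn (slab ℝ³ (Ioo 0 T) isOpen_Ioo) ν 0 u p →
      (∀ t₁ ∈ Ioo 0 T, ∀ ρ : ℝ, 0 < ρ →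
          (∃ C : ℝ≥0, ∀ t ∈ Ioo t₁ T, ∫⁻ x in ball (0 : ℝ³) ρ, ‖u t x‖ₑ ^ 2 ≤ C) ∧
          (∫⁻ z in Ioo t₁ T ×ˢ ball (0 : ℝ³) ρ,
              ENNReal.ofReal (frobeniusNormSq (fderiv ℝ (u z.1) z.2)) < ∞) ∧
          (∫⁻ z in Ioo t₁ T ×ˢ ball (0 : ℝ³) ρ, ‖p z.1 z.2‖ₑ ^ (3 / 2 : ℝ) < ∞)) →
      (∃ t₀ ∈ Ioo 0 T, ∃ δ₀ : ℝ, 0 < δ₀ ∧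
          ∀ t ∈ Ico t₀ T, ∀ x : ℝ³, cylRadius x ≤ δ₀ → |swirl (u t) x| ≤ ε₀ * ν) →
      ∀ x₀ : ℝ³, cylRadius x₀ = 0 → IsBoundedNearTop u T x₀

/-- **P2 — continuity of the swirl at the axis up to the final time (no rate).**  For a Kato
solution on `[0,T)`, smooth with axisymmetric slices on `(0,T)`, and any `0 < t₀ < T`: the swirl
tends to `0` at the axis UNIFORMLY on `[t₀, T) × ℝ³` — for every `ε > 0` there is `δ > 0` with
`|Γ(t,x)| ≤ ε` whenever `cylRadius x ≤ δ`, `t ∈ [t₀,T)`.  (A consequence of the crux; open as an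
a-priori statement: the drift `b = u_r e_r + u_z e_z` of the swirl equation is only known to obey
the supercritical bound `|b| ≲ √|ln r| / r²`, Lei–Navas–Zhang 2016.) -/
def AxisSwirlContinuity : Prop :=
  ∀ ν : ℝ, 0 < ν → ∀ T : ℝ, 0 < T → ∀ (u₀ : ℝ³ → ℝ³)
    (g : HomSobolev ℝ³ (EuclideanSpace ℂ (Fin 3)) (1 / 2 : ℝ)) (u : ℝ → ℝ³ → ℝ³),
    g.Represents (Literature.Analysis.FunctionSpaces.EuclideanSpace.complexify ∘ u₀) →
    IsKatoSolutionOn T ν u₀ u → ContDiffOn ℝ (⊤ : ℕ∞) (uncurry u) (Ioo 0 T ×ˢ univ) →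
    (∀ t ∈ Ioo 0 T, IsAxisymmetric (u t)) →
    ∀ t₀ ∈ Ioo 0 T, ∀ ε : ℝ, 0 < ε → ∃ δ : ℝ, 0 < δ ∧
      ∀ t ∈ Ico t₀ T, ∀ x : ℝ³, cylRadius x ≤ δ → |swirl (u t) x| ≤ ε

/-- KERNEL CERTIFICATE 3 (the D7 assembly is PROVED from landed stubs).
`SmallSwirlEndpointCriterion → AxisSwirlContinuity → AxisymmetricKatoGlobal`: blow-up ⇒ a
smooth axisymmetric Kato solution with a singular point `(T, x_*)` (stub 1); the Calderón /
Rusin–Šverák splitting gives a suitable pair with local energy up to `T` (stub K); off the axis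
`x_*` is bounded by ε-regularity + rotation packing (stub 2b'); on the axis, P2 at `ε = ε₀ ν`
feeds P1; either way `x_*` is bounded near `T`, contradicting its singularity. -/
theorem akg_of_endpoint_of_continuity (h1 : SmallSwirlEndpointCriterion)
    (h2 : AxisSwirlContinuity) : AxisymmetricKatoGlobal := by
  obtain ⟨ε₀, hε₀, hcrit⟩ := h1
  intro ν hν u₀ g hL3 hrep hdiv hax
  have hax' : IsAxisymmetric u₀ := fun θ x => hax θ x
  by_contra hng
  obtain ⟨T, hT, xs, u, hK, hsm, haxi, hsing⟩ :=
    Registered.stub_katoAxisymSingularPoint ν hν u₀ hL3 hdiv hax' hng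
  have ht₀ : T / 2 ∈ Ioo 0 T := ⟨by linarith, by linarith⟩
  obtain ⟨δ, hδ, hmod⟩ :=
    h2 ν hν T hT u₀ g u hrep hK hsm haxi (T / 2) ht₀ (ε₀ * ν) (mul_pos hε₀ hν)
  obtain ⟨p, hpax, hsw, hloc⟩ := Registered.stub_katoLocalEnergyNearTop ν hν T hT u₀ u hK hsm haxi
  have hbd : IsBoundedNearTop u T xs := by
    by_cases h0 : cylRadius xs = 0
    · exact hcrit ν hν T hT u p hsm haxi hpax hsw hloc ⟨T / 2, ht₀, δ, hδ, hmod⟩ xs h0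
    · exact Registered.stub_offAxisBounded_of_localEnergy ν hν T hT u p hsm haxi hsw hloc xs h0
  obtain ⟨r, hr, K, hbd'⟩ := hbd
  exact absurd (hsing r hr) (Registered.eLpNorm_parabolicCylinder_lt_top_of_forall_le hbd').ne

/-- KERNEL CERTIFICATE 4.  The continuity half P2 is formally WEAKER than the registered stub 3
(`SwirlAxisModulus`): a `C/|log r|³` modulus on `{r ≤ δ₀ < 1}` gives, for every `ε > 0`, a radius
below which `|Γ| ≤ ε`. -/
theorem axisSwirlContinuity_of_swirlAxisModulus (h : SwirlAxisModulus) : AxisSwirlContinuity := by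
  intro ν hν T hT u₀ g u hrep hK hsm haxi t₀ ht₀ ε hε
  obtain ⟨C, δ₀, hδ₀, hδ₁, hmod⟩ := h ν hν T hT u₀ g u hrep hK hsm haxi t₀ ht₀
  -- radius `δ = min δ₀ (exp (-(M+1)))` with `M ^ 3 ≥ |C| / ε`-type control; we take `M = |C|/ε + 1`
  -- so that `|log r| ≥ M ≥ 1` and `|log r|^3 ≥ |log r| ≥ |C|/ε + 1 > |C| / ε`.
  set M : ℝ := |C| / ε + 1 with hM
  have hMpos : 0 < M := by positivity
  refine ⟨min δ₀ (Real.exp (-M)), lt_min hδ₀ (Real.exp_pos _), ?_⟩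
  intro t ht x hx
  have hxδ₀ : cylRadius x ≤ δ₀ := hx.trans (min_le_left _ _)
  have hxexp : cylRadius x ≤ Real.exp (-M) := hx.trans (min_le_right _ _)
  have hbound := hmod t ht x hxδ₀
  -- case split on whether `cylRadius x = 0` (then `log 0 = 0` and the bound reads `|Γ| ≤ C/0 = 0`)
  by_cases hr0 : cylRadius x = 0
  · have : |swirl (u t) x| ≤ 0 := by simpa [hr0] using hbound
    linarith [abs_nonneg (swirl (u t) x)]
  · have hrpos : 0 < cylRadius x := lt_of_le_of_ne (cylRadius_nonneg x) (Ne.symm hr0)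
    -- `log r ≤ -M`, hence `|log r| ≥ M`
    have hlog : Real.log (cylRadius x) ≤ -M := by
      have := Real.log_le_log hrpos hxexp
      simpa [Real.log_exp] using this
    have habs : M ≤ |Real.log (cylRadius x)| := by
      have : M ≤ -Real.log (cylRadius x) := by linarith
      exact this.trans (neg_le_abs _)
    have hM1 : 1 ≤ M := by
      have : 0 ≤ |C| / ε := by positivity
      linarith
    have habs1 : 1 ≤ |Real.log (cylRadius x)| := hM1.trans habs
    -- `|log r|^3 ≥ |log r| ≥ M`
    have hcube : M ≤ |Real.log (cylRadius x)| ^ 3 := by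
      have h1 : |Real.log (cylRadius x)| ≤ |Real.log (cylRadius x)| ^ 3 := by
        calc |Real.log (cylRadius x)| = |Real.log (cylRadius x)| ^ 1 := (pow_one _).symm
          _ ≤ |Real.log (cylRadius x)| ^ 3 := pow_le_pow_right₀ habs1 (by norm_num)
      exact habs.trans h1
    have hcubepos : 0 < |Real.log (cylRadius x)| ^ 3 := hMpos.trans_le hcube
    -- `C / |log r|^3 ≤ |C| / M ≤ ε`
    have hstep : C / |Real.log (cylRadius x)| ^ 3 ≤ |C| / M := by
      calc C / |Real.log (cylRadius x)| ^ 3 ≤ |C| / |Real.log (cylRadius x)| ^ 3 :=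
            div_le_div_of_nonneg_right (le_abs_self C) hcubepos.le
        _ ≤ |C| / M := div_le_div_of_nonneg_left (abs_nonneg C) hMpos hcube
    have hfin : |C| / M ≤ ε := by
      rw [div_le_iff₀ hMpos, hM]
      have : |C| = ε * (|C| / ε) := by field_simp
      nlinarith [abs_nonneg C, hε.le]
    exact hbound.trans (hstep.trans hfin)

/-! ## §3  Strengthenings considered (typed where cheap). -/

/-- **S⁺ (pointwise-in-time critical bound)** — the Kenig–Merle / Seregin-2012 shaped
strengthening: axisymmetric Kato solutions have `L³` norm bounded up to the final time by a
function of the datum's `Ḣ^{1/2}` class norm and `ν`.  (With Seregin 2012 / ESŠ 2003 this gives the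
crux; it is STRONGER than the crux and no mechanism bounds a critical norm along the flow —
recorded as giving no leverage.) -/
def AxisymCriticalNormBound : Prop :=
  ∀ ν : ℝ, 0 < ν → ∃ F : ℝ≥0∞ → ℝ≥0∞, (∀ ρ : ℝ≥0∞, ρ < ∞ → F ρ < ∞) ∧
    ∀ T : ℝ, 0 < T → ∀ (u₀ : ℝ³ → ℝ³)
      (g : HomSobolev ℝ³ (EuclideanSpace ℂ (Fin 3)) (1 / 2 : ℝ)) (u : ℝ → ℝ³ → ℝ³),
      g.Represents (Literature.Analysis.FunctionSpaces.EuclideanSpace.complexify ∘ u₀) →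
      IsKatoSolutionOn T ν u₀ u → (∀ t ∈ Ioo 0 T, IsAxisymmetric (u t)) →
      ∀ t ∈ Ioo 0 T, eLpNorm (u t) 3 volume ≤ F ‖g‖ₑ

-- audit: the census's kernel facts conclude the crux BY NAME
example : SwirlAxisModulus → AxisymmetricKatoGlobal := akg_of_swirlAxisModulus
example : SmallSwirlEndpointCriterion → AxisSwirlContinuity →
    Summit.NavierStokesRegularity.NavierStokesRegularity.Theses.AxisymmetricExtremality.AxisymmetricKatoGlobal :=
  akg_of_endpoint_of_continuity

end Summit.NavierStokesRegularity.NavierStokesRegularity.Cruxes.AxisymmetricKatoGlobal.StrategistS19g9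

end
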